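import Summits.NavierStokesRegularity.NavierStokesRegularity.Theorems.SymmetryModuliCountLinearLiouvilleSevenOfTarget
import Summits.NavierStokesRegularity.NavierStokesRegularity.Theorems.SqueezeCycleExtremalBiaxialitySubcriticalSmallConstant
import Summits.NavierStokesRegularity.NavierStokesRegularity.Theorems.SymmetryModuliCountHelicalEndLiouvilleForwardVanishing
import Literature.Analysis.UnboundedOperators.HeatKernelLpSmoothingProofs
import Literature.Analysis.FluidPDE.NSBoundedMildOseenDuhamel
import HarnessLib

/-!
# Type-I ancient mild solutions with a bounded subcritical norm are trivial;
# `LinearLiouvilleSeven` about finite-energy backgrounds (item stmt-NavierStokesRegularity-4054)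

Route `SymmetryModuliCount`, sub-problem `NavierStokesRegularity`. The support item
`LinearLiouvilleSeven` (LL7) is the route target `X = TypeIAncientLiouville` in costume
(`linearLiouvilleSeven_iff_typeIAncientLiouville`), and background by background the conclusion of
LL7 about `u ∈ A_C` holds iff `u ≡ 0` (file `SymmetryModuliCountLinearLiouvilleSevenPointwise`).
This file proves `X` — hence LL7 — on the FINITE-ENERGY part of every class `A_C`:

* `exists_typeIAncientMild_eq_zero_of_small_on_end` — THE FAR PAST DECIDES: with the universal
  small constant `ε` of `exists_typeIAncientMild_eq_zero_of_small`, an element of any `A_C`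
  obeying `‖u(t,x)‖ ≤ ε/√(−t)` merely on some backward end `t ≤ −R` vanishes identically (shift
  the end to `(−∞, 0)`, apply the small-constant Liouville theorem, propagate forward by
  uniqueness); contrapositive `exists_typeIAncientMild_farPast_lower_bound` — Leray's lower bound
  in ancient form on every backward end: a nonzero element has `sup_{t ≤ −R} √(−t)‖u(t)‖_∞ ≥ ε`
  for all `R > 0`;
* `norm_heatExtension_le_of_eLpNorm_le` (`…_two_le`) — the pointwise `Lᵖ → L^∞` bound of the
  heat semigroup on `ℝ³`, `‖e^{σΔ}f(x)‖ ≤ ((4πσ)^{-3/2})^{1/p} ‖f‖_{Lᵖ}` (Hölder against the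
  Gaussian);
* `typeIAncientMild_eq_zero_of_eLpNorm_le` — **a Type-I ancient mild field in the Oseen gauge
  with a uniformly bounded SUBCRITICAL Lebesgue norm, `sup_{t<0} ‖u(t)‖_{Lᵖ} < ∞` for some
  `1 ≤ p < 3`, vanishes identically** (`…_two_le`: the finite-energy case `p = 2`). On the window
  `((1+θ)t, t)` the caloric part of the Oseen identity is `O((θ|t|)^{-3/(2p)})` by the smoothing
  bound — faster than the critical rate `|t|^{-1/2}` exactly when `p < 3` — and the bilinear part
  is `≤ 2C_B C²√θ/√|t|` by the `L^∞` bound of the Oseen bilinear term (KNSS 2009 §4); so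
  `√|t| ‖u(t)‖_∞ ≤ ε` on a backward end `t ≤ −R`, where `ε` is the universal small constant of
  `exists_typeIAncientMild_eq_zero_of_small` (Leray's lower blow-up-rate bound in ancient form);
  the time-shifted field `u(· − R)` lies in `A_ε`, hence is zero, and vanishing on a backward end
  propagates forward (`stub_forwardVanishing`). No smallness of `C` or of the norm bound is
  needed; the critical case `p = 3` is exactly where the gain disappears (there the statement is
  the Escauriaza–Seregin–Šverák backward-uniqueness theorem, not attempted here);
* `dependentModSlice_of_eLpNorm_le` (`…_two_le`) — hence LL7 holds about every such background;
* `stub_typeIAncientLiouvilleSubcritical`, `stub_typeIAncientLiouvilleFiniteEnergy`,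
  `stub_linearLiouvilleSevenFiniteEnergy` — the same facts in the registered raw vocabulary of
  the route file.

Blow-up (zoom-in) limits have infinite energy and only locally bounded subcritical norms, so this
does not bear on Type-I blow-up; it pins the content of `X`/LL7 to backgrounds with
`sup_t ‖u(t)‖_{Lᵖ} = ∞` for every `p < 3`, Type-I constant above the universal `ε`, `u ≠ 0`.

## References

* G. Koch, N. Nadirashvili, G. Seregin, V. Šverák, *Liouville theorems for the Navier–Stokes
  equations and applications*, Acta Math. 203 (2009) = arXiv:0709.3599, §4 p. 8 (the bilinear
  bound `‖B(u,v)‖_∞ ≤ C√T‖u‖‖v‖`, forward uniqueness), §1 (1.4). [KNSS2009]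
* J. Leray, Acta Math. 63 (1934), (3.9). [Leray1934]
* Y. Giga, M.-H. Giga, J. Saal, *Nonlinear PDEs*, §1.1.2–1.1.3 (heat `Lᵖ → L^q`). [GigaGigaSaal2010]
-/

noncomputable section

set_option linter.dupNamespace false -- tree namespace `Summit.<S>.<S>.Theorems` (summit = sub-problem), as in every Theorems file

open Set Function MeasureTheory Filter
open scoped Laplacian ContDiff Topology RealInnerProductSpace BigOperators ENNReal

namespace Summit.NavierStokesRegularity.NavierStokesRegularity.Theorems

open Literature.Analysis Literature.Analysis.FluidPDE Literature.Analysis.UnboundedOperators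
open Summit.NavierStokesRegularity.NavierStokesRegularity.Theses.SymmetryModuliCount
open Summit.NavierStokesRegularity.NavierStokesRegularity.Theorems.LinearLiouvilleSeven.Negative

/-- The `L² → L^∞` decay constant of the heat semigroup on `ℝ³` at time `σ`:
`A(σ) = ((4πσ)^{-3/2})^{1/2} = (4πσ)^{-3/4}`. -/
theorem norm_heatExtension_le_of_eLpNorm_two_le {f : E3 → E3}
    (hf : AEStronglyMeasurable f volume) {N : ℝ} (hN : 0 ≤ N)
    (hfN : eLpNorm f 2 volume ≤ ENNReal.ofReal N) {σ : ℝ} (hσ : 0 < σ) (x : E3) :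
    ‖heatExtension f σ x‖ ≤ ((4 * Real.pi * σ) ^ (-(3 : ℝ) / 2)) ^ (1 / 2 : ℝ) * N := by
  have hK : AEStronglyMeasurable (heatKernel (E := E3) σ) volume :=
    (continuous_heatKernel σ).aestronglyMeasurable
  have h1 : ‖heatExtension f σ x‖ₑ ≤ eLpNorm (heatKernel (E := E3) σ) 2 volume * eLpNorm f 2 volume :=
    enorm_convolution_lsmul_le_eLpNorm_mul_eLpNorm hK hf 2 2 x
  have h2 : eLpNorm (heatKernel (E := E3) σ) 2 volume ≤
      ENNReal.ofReal ((4 * Real.pi * σ) ^ (-(3 : ℝ) / 2)) ^ (1 / 2 : ℝ) := by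
    have := eLpNorm_heatKernel_le (E := E3) hσ (r := 2) (by norm_num)
    have hfin : (Module.finrank ℝ E3 : ℝ) = 3 := by simp
    rw [hfin] at this
    convert this using 2
    rw [ENNReal.one_sub_inv_two, ENNReal.toReal_inv]
    norm_num
  have h0 : 0 ≤ (4 * Real.pi * σ) ^ (-(3 : ℝ) / 2) := Real.rpow_nonneg (by positivity) _
  have h3 : ‖heatExtension f σ x‖ₑ ≤
      ENNReal.ofReal (((4 * Real.pi * σ) ^ (-(3 : ℝ) / 2)) ^ (1 / 2 : ℝ) * N) := by
    calc ‖heatExtension f σ x‖ₑ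
        ≤ eLpNorm (heatKernel (E := E3) σ) 2 volume * eLpNorm f 2 volume := h1
      _ ≤ ENNReal.ofReal ((4 * Real.pi * σ) ^ (-(3 : ℝ) / 2)) ^ (1 / 2 : ℝ) * ENNReal.ofReal N := by
          gcongr
      _ = ENNReal.ofReal (((4 * Real.pi * σ) ^ (-(3 : ℝ) / 2)) ^ (1 / 2 : ℝ) * N) := by
          rw [ENNReal.ofReal_mul (Real.rpow_nonneg h0 _), ENNReal.ofReal_rpow_of_nonneg h0 (by norm_num)]
  rw [← ofReal_norm] at h3
  exact (ENNReal.ofReal_le_ofReal_iff (mul_nonneg (Real.rpow_nonneg h0 _) hN)).1 h3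


/-! ### The far past decides: smallness on a backward end forces triviality -/

/-- **Smallness on a backward end forces triviality.** There is a universal `ε > 0` such that a
Type-I ancient mild field `u` (any constant `C`) obeying the SMALL Type-I bound
`‖u(t,x)‖ ≤ ε/√(−t)` merely on some backward end `t ≤ −R` vanishes identically on `t < 0`:
the time-shifted field `s ↦ u(s − R)` is a Type-I ancient mild field with constant `ε`
(`IsTypeIAncientMild.comp_sub_right` and `ε/√(R − s) ≤ ε/√(−s)`), hence zero by
`exists_typeIAncientMild_eq_zero_of_small`, so `u ≡ 0` on `t < −R`, and vanishing on a backward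
end propagates forward (`stub_forwardVanishing`, forward uniqueness of bounded mild solutions,
KNSS 2009 §4). [cite: KochNadirashviliSereginSverak2009, §4 p. 8 (arXiv:0709.3599); Leray1934, (3.9)] -/
theorem exists_typeIAncientMild_eq_zero_of_small_on_end :
    ∃ ε : ℝ, 0 < ε ∧ ∀ (C : ℝ) (u : ℝ → E3 → E3), IsTypeIAncientMild C u → ∀ R : ℝ, 0 < R →
      (∀ t, t ≤ -R → ∀ x, ‖u t x‖ ≤ ε / Real.sqrt (-t)) → ∀ t < 0, ∀ x, u t x = 0 := by
  obtain ⟨ε, hε, hsmall⟩ := exists_typeIAncientMild_eq_zero_of_small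
  refine ⟨ε, hε, fun C u hu R hR0 hdecay => ?_⟩
  -- the shifted field `s ↦ u(s - R)` is a Type-I ancient mild field with the SMALL constant `ε`
  have hshift : IsTypeIAncientMild ε (fun s => u (s - R)) := by
    have h1 := hu.comp_sub_right hR0.le
    refine ⟨h1.1, h1.2.1, h1.2.2.1, fun s hs x => ?_⟩
    have hsR : s - R ≤ -R := by linarith
    refine (hdecay (s - R) hsR x).trans ?_
    exact div_le_div_of_nonneg_left hε.le (Real.sqrt_pos.2 (by linarith))
      (Real.sqrt_le_sqrt (by linarith))
  -- so `u` vanishes on the backward end `t < -R`, hence everywhere (forward uniqueness)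
  have hzero_end : ∀ t < -R, ∀ x, u t x = 0 := by
    intro t ht x
    have := hsmall ε (fun s => u (s - R)) hshift le_rfl (t + R) (by linarith) x
    simpa using this
  exact stub_forwardVanishing C u hu (-R) (by linarith) hzero_end

/-- **Leray's lower bound in ancient form, on every backward end.** With the universal `ε > 0`
of `exists_typeIAncientMild_eq_zero_of_small_on_end`: a Type-I ancient mild field which is
nonzero somewhere on `t < 0` violates the small bound arbitrarily far in the past — for every
`R > 0` there are `t ≤ −R` and `x` with `‖u(t,x)‖ > ε/√(−t)`. Equivalently
`sup_{t ≤ −R} √(−t)‖u(t)‖_∞ ≥ ε` for all `R`: the far past of a nonzero element never drops below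
the universal threshold. [cite: Leray1934, (3.9); KochNadirashviliSereginSverak2009, §4 p. 8 (arXiv:0709.3599)] -/
theorem exists_typeIAncientMild_farPast_lower_bound :
    ∃ ε : ℝ, 0 < ε ∧ ∀ (C : ℝ) (u : ℝ → E3 → E3), IsTypeIAncientMild C u →
      (∃ t < 0, ∃ x, u t x ≠ 0) → ∀ R : ℝ, 0 < R → ∃ t ≤ -R, ∃ x, ε / Real.sqrt (-t) < ‖u t x‖ := by
  obtain ⟨ε, hε, hend⟩ := exists_typeIAncientMild_eq_zero_of_small_on_end
  refine ⟨ε, hε, fun C u hu hne R hR => ?_⟩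
  by_contra h
  push Not at h
  obtain ⟨t, ht, x, hx⟩ := hne
  exact hx (hend C u hu R hR h t ht x)

/-- The pointwise `Lᵖ → L^∞` bound of the heat semigroup on `ℝ³`, `1 ≤ p ≤ ∞`:
`‖e^{σΔ}f(x)‖ ≤ ((4πσ)^{-3/2})^{1/p} ‖f‖_{Lᵖ}` (Hölder against the Gaussian, whose `L^{p'}` norm
is at most `((4πσ)^{-3/2})^{1/p}` by interpolation between mass one and the sup bound).
[cite: GigaGigaSaal2010, §1.1.2–1.1.3] -/
theorem norm_heatExtension_le_of_eLpNorm_le {f : E3 → E3}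
    (hf : AEStronglyMeasurable f volume) {p : ℝ≥0∞} (hp : 1 ≤ p) {N : ℝ} (hN : 0 ≤ N)
    (hfN : eLpNorm f p volume ≤ ENNReal.ofReal N) {σ : ℝ} (hσ : 0 < σ) (x : E3) :
    ‖heatExtension f σ x‖ ≤ ((4 * Real.pi * σ) ^ (-(3 : ℝ) / 2)) ^ p⁻¹.toReal * N := by
  haveI : p.HolderConjugate p.conjExponent := .conjExponent hp
  have hK : AEStronglyMeasurable (heatKernel (E := E3) σ) volume :=
    (continuous_heatKernel σ).aestronglyMeasurable
  have h1 : ‖heatExtension f σ x‖ₑ ≤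
      eLpNorm (heatKernel (E := E3) σ) p.conjExponent volume * eLpNorm f p volume :=
    enorm_convolution_lsmul_le_eLpNorm_mul_eLpNorm hK hf p.conjExponent p x
  have h2 : eLpNorm (heatKernel (E := E3) σ) p.conjExponent volume ≤
      ENNReal.ofReal ((4 * Real.pi * σ) ^ (-(3 : ℝ) / 2)) ^ p⁻¹.toReal := by
    have := eLpNorm_heatKernel_le (E := E3) hσ (r := p.conjExponent)
      (ENNReal.HolderConjugate.one_le p.conjExponent p)
    have hfin : (Module.finrank ℝ E3 : ℝ) = 3 := by simp
    rw [hfin, ENNReal.HolderConjugate.one_sub_inv p.conjExponent p] at this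
    convert this using 3
  have h0 : 0 ≤ (4 * Real.pi * σ) ^ (-(3 : ℝ) / 2) := Real.rpow_nonneg (by positivity) _
  have h3 : ‖heatExtension f σ x‖ₑ ≤
      ENNReal.ofReal (((4 * Real.pi * σ) ^ (-(3 : ℝ) / 2)) ^ p⁻¹.toReal * N) := by
    calc ‖heatExtension f σ x‖ₑ
        ≤ eLpNorm (heatKernel (E := E3) σ) p.conjExponent volume * eLpNorm f p volume := h1
      _ ≤ ENNReal.ofReal ((4 * Real.pi * σ) ^ (-(3 : ℝ) / 2)) ^ p⁻¹.toReal * ENNReal.ofReal N := by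
          gcongr
      _ = ENNReal.ofReal (((4 * Real.pi * σ) ^ (-(3 : ℝ) / 2)) ^ p⁻¹.toReal * N) := by
          rw [ENNReal.ofReal_mul (Real.rpow_nonneg h0 _),
            ENNReal.ofReal_rpow_of_nonneg h0 ENNReal.toReal_nonneg]
  rw [← ofReal_norm] at h3
  exact (ENNReal.ofReal_le_ofReal_iff (mul_nonneg (Real.rpow_nonneg h0 _) hN)).1 h3

/-- Parabolic scaling of the `Lᵖ → L^∞` heat decay on a window of relative length `θ`:
`√r · ((4π θ r)^{-3/2})^{a} = (4πθ)^{-3a/2} r^{-(3a/2 − 1/2)}` (`θ, r > 0`). -/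
theorem sqrt_mul_heatDecay_rpow_eq {θ r : ℝ} (hθ : 0 < θ) (hr : 0 < r) (a : ℝ) :
    Real.sqrt r * ((4 * Real.pi * (θ * r)) ^ (-(3 : ℝ) / 2)) ^ a =
      (4 * Real.pi * θ) ^ (-(3 : ℝ) / 2 * a) * r ^ (-(3 / 2 * a - 1 / 2)) := by
  have hb : (0 : ℝ) ≤ 4 * Real.pi * (θ * r) := by positivity
  have h4 : (0 : ℝ) ≤ 4 * Real.pi * θ := by positivity
  rw [← Real.rpow_mul hb, show (4 * Real.pi * (θ * r)) = (4 * Real.pi * θ) * r by ring,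
    Real.mul_rpow h4 hr.le, Real.sqrt_eq_rpow, mul_left_comm, ← Real.rpow_add hr]
  congr 2
  ring

/-- **Type-I ancient mild solutions with a uniformly bounded subcritical Lebesgue norm are
trivial.** If `u` is a Type-I ancient mild field in the Oseen gauge (`IsTypeIAncientMild C u`)
and `‖u(t)‖_{Lᵖ} ≤ N` for all `t < 0`, for some `1 ≤ p < 3`, then `u ≡ 0` on `t < 0`. Proof:
on the window `((1+θ)t, t)` write `u(t) = e^{θ|t|Δ}u((1+θ)t) − B_{(1+θ)t}(u,u)(t)`; the caloric
part is at most `(4πθ|t|)^{-3/(2p)} N` (`Lᵖ → L^∞` smoothing — subcritical: `3/(2p) > 1/2`), the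
bilinear part at most `2 C_B C² √θ/√|t|` (KNSS 2009 §4, the `L^∞` bound of the Oseen bilinear
term on a window where `|u| ≤ C/√|t|`). Choosing `√θ = ε/(4 C_B C² + 1)` and then `|t| ≥ R`
large, `√|t| ‖u(t)‖_∞ ≤ ε`, the universal small constant of
`exists_typeIAncientMild_eq_zero_of_small` (Leray's lower blow-up-rate bound in ancient form);
the time-shifted field `u(· − R)` is then a Type-I ancient mild field with constant `ε`, hence
zero, so `u` vanishes on the backward end `t < −R` and therefore everywhere
(`stub_forwardVanishing`, forward uniqueness). No smallness of `C` or `N` is needed; the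
critical case `p = 3` is exactly where the gain disappears.
[cite: KochNadirashviliSereginSverak2009, §4 p. 8 (arXiv:0709.3599); Leray1934, (3.9)] -/
theorem typeIAncientMild_eq_zero_of_eLpNorm_le {C N : ℝ} {p : ℝ≥0∞} (hp1 : 1 ≤ p) (hp3 : p < 3)
    {u : ℝ → E3 → E3} (hu : IsTypeIAncientMild C u)
    (hN : ∀ t < 0, eLpNorm (u t) p volume ≤ ENNReal.ofReal N) :
    ∀ t < 0, ∀ x, u t x = 0 := by
  obtain ⟨ε, hε, hend⟩ := exists_typeIAncientMild_eq_zero_of_small_on_end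
  obtain ⟨C_B, hCB, hB⟩ := exists_norm_oseenDuhamel_bounded_le (E := E3)
  have hC : 0 ≤ C := hu.nonneg
  -- the smoothing exponent `a = 1/p ∈ (1/3, 1]`, decay gain `y = 3a/2 - 1/2 > 0`
  set a : ℝ := p⁻¹.toReal with ha
  have ha3 : 1 / 3 < a := by
    have hpt : p ≠ ⊤ := ne_top_of_lt hp3
    have hp0 : p ≠ 0 := (zero_lt_one.trans_le hp1).ne'
    have h3 : p.toReal < 3 := by
      have := (ENNReal.toReal_lt_toReal hpt (by norm_num : (3 : ℝ≥0∞) ≠ ⊤)).2 hp3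
      simpa using this
    have hpos : 0 < p.toReal := ENNReal.toReal_pos hp0 hpt
    rw [ha, ENNReal.toReal_inv, one_div]
    exact (inv_lt_inv₀ (by norm_num) hpos).2 h3
  set y : ℝ := 3 / 2 * a - 1 / 2 with hy
  have hy0 : 0 < y := by rw [hy]; linarith
  -- WLOG `N ≥ 0`
  set N' : ℝ := max N 0 with hN'
  have hN'0 : 0 ≤ N' := le_max_right _ _
  have hN'le : ∀ t < 0, eLpNorm (u t) p volume ≤ ENNReal.ofReal N' := fun t ht =>
    (hN t ht).trans (ENNReal.ofReal_le_ofReal (le_max_left _ _))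
  -- the window parameter `θ`: `2 C_B C² √θ ≤ ε/2`
  have hden : 0 < 4 * C_B * C ^ 2 + 1 := by positivity
  set θ : ℝ := (ε / (4 * C_B * C ^ 2 + 1)) ^ 2 with hθ
  have hθ0 : 0 < θ := by positivity
  have hsqθ : Real.sqrt θ = ε / (4 * C_B * C ^ 2 + 1) := by
    rw [hθ, Real.sqrt_sq (by positivity)]
  have hwin : 2 * C_B * C ^ 2 * Real.sqrt θ ≤ ε / 2 := by
    rw [hsqθ, show 2 * C_B * C ^ 2 * (ε / (4 * C_B * C ^ 2 + 1)) =
      ε * (2 * C_B * C ^ 2) / (4 * C_B * C ^ 2 + 1) by ring, div_le_iff₀ hden]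
    nlinarith [hε, hCB, sq_nonneg C]
  -- the far-past threshold from the heat decay: `K r^{-y} < ε/2` for `r ≥ R₀`
  set K : ℝ := (4 * Real.pi * θ) ^ (-(3 : ℝ) / 2 * a) * N' with hK
  have hev : ∀ᶠ r in atTop, K * r ^ (-y) < ε / 2 := by
    have hT : Tendsto (fun r : ℝ => K * r ^ (-y)) atTop (𝓝 (K * 0)) :=
      (tendsto_rpow_neg_atTop hy0).const_mul K
    rw [mul_zero] at hT
    exact hT.eventually (gt_mem_nhds (half_pos hε))
  obtain ⟨R₀, hR₀⟩ := Filter.eventually_atTop.1 hev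
  set R : ℝ := max R₀ 1 with hR
  have hR0 : 0 < R := lt_of_lt_of_le one_pos (le_max_right _ _)
  -- decay on the backward end `t ≤ -R`: `‖u t x‖ ≤ ε/√(-t)`
  have hdecay : ∀ t, t ≤ -R → ∀ x, ‖u t x‖ ≤ ε / Real.sqrt (-t) := by
    intro t htR x
    have ht : t < 0 := by linarith
    have hr : 0 < -t := by linarith
    set t₁ : ℝ := (1 + θ) * t with ht₁
    have hθt : θ * t < 0 := mul_neg_of_pos_of_neg hθ0 ht
    have ht₁t : t₁ < t := by rw [ht₁]; linarith
    have hgap : t - t₁ = θ * (-t) := by rw [ht₁]; ring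
    have hspos : 0 < Real.sqrt (-t) := Real.sqrt_pos.2 hr
    -- the Oseen identity on the window `(t₁, t)`
    have hmild := hu.mild_eq_heatExtension ht₁t ht x
    -- caloric part
    have hheat : ‖heatExtension (u t₁) (t - t₁) x‖ ≤
        ((4 * Real.pi * (θ * (-t))) ^ (-(3 : ℝ) / 2)) ^ a * N' := by
      rw [hgap]
      exact norm_heatExtension_le_of_eLpNorm_le (hu.aestronglyMeasurable_slice (ht₁t.trans ht))
        hp1 hN'0 (hN'le t₁ (ht₁t.trans ht)) (by positivity) x
    have hscale : Real.sqrt (-t) * (((4 * Real.pi * (θ * (-t))) ^ (-(3 : ℝ) / 2)) ^ a * N') =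
        K * (-t) ^ (-y) := by
      rw [← mul_assoc, sqrt_mul_heatDecay_rpow_eq hθ0 hr a, hK]; ring
    have hfar : K * (-t) ^ (-y) < ε / 2 := hR₀ (-t) (by linarith [le_max_left R₀ 1])
    have hheat' : ((4 * Real.pi * (θ * (-t))) ^ (-(3 : ℝ) / 2)) ^ a * N' ≤
        (ε / 2) / Real.sqrt (-t) := by
      have h := hfar.le
      rw [← hscale] at h
      rwa [le_div_iff₀ hspos, mul_comm]
    -- bilinear part
    have hM : 0 ≤ C / Real.sqrt (-t) := div_nonneg hC (Real.sqrt_nonneg _)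
    have hwinb : ∀ τ ∈ Ioo t₁ t, ∀ y, ‖u τ y‖ ≤ C / Real.sqrt (-t) :=
      fun τ hτ y => hu.norm_le_of_mem_Ioo ht hτ y
    have hduh : ‖oseenDuhamel 1 t₁ u u t x‖ ≤
        C_B * (C / Real.sqrt (-t)) ^ 2 * (1 : ℝ) ^ (-(1 / 2 : ℝ)) * (2 * Real.sqrt (t - t₁)) :=
      hB one_pos ht₁t hM hwinb hwinb x
    have hduh' : ‖oseenDuhamel 1 t₁ u u t x‖ ≤ 2 * C_B * C ^ 2 * Real.sqrt θ / Real.sqrt (-t) := by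
      refine hduh.trans (le_of_eq ?_)
      rw [hgap, Real.one_rpow, Real.sqrt_mul hθ0.le]
      field_simp
    -- assemble
    calc ‖u t x‖ = ‖heatExtension (u t₁) (t - t₁) x - oseenDuhamel 1 t₁ u u t x‖ := by rw [← hmild]
      _ ≤ ‖heatExtension (u t₁) (t - t₁) x‖ + ‖oseenDuhamel 1 t₁ u u t x‖ := norm_sub_le _ _
      _ ≤ (ε / 2) / Real.sqrt (-t) + (ε / 2) / Real.sqrt (-t) := by
          gcongr
          · exact hheat.trans hheat'
          · exact hduh'.trans (div_le_div_of_nonneg_right hwin hspos.le)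
      _ = ε / Real.sqrt (-t) := by ring
  -- the far past decides
  exact hend C u hu R hR0 hdecay

/-- **Finite-energy Type-I ancient mild solutions are trivial** (the case `p = 2` of
`typeIAncientMild_eq_zero_of_eLpNorm_le`): a Type-I ancient mild field in the Oseen gauge whose
slices have uniformly bounded `L²` norm, `‖u(t)‖_{L²} ≤ N` for `t < 0`, vanishes identically.
The energy of blow-up limits is infinite, so this does not touch Type-I blow-up; it records that
the Liouville statement `X` holds on the finite-energy part of every `A_C`.
[cite: KochNadirashviliSereginSverak2009, §4 p. 8 (arXiv:0709.3599); Leray1934, (3.9)] -/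
theorem typeIAncientMild_eq_zero_of_eLpNorm_two_le {C N : ℝ} {u : ℝ → E3 → E3}
    (hu : IsTypeIAncientMild C u) (hN : ∀ t < 0, eLpNorm (u t) 2 volume ≤ ENNReal.ofReal N) :
    ∀ t < 0, ∀ x, u t x = 0 :=
  typeIAncientMild_eq_zero_of_eLpNorm_le (p := 2) (by norm_num) (by norm_num) hu hN


/-! ### Consequences for the item `LinearLiouvilleSeven` -/

/-- **`LinearLiouvilleSeven` holds about every finite-energy background**: if `u ∈ A_C` has
slices of uniformly bounded `L²` norm then any seven tempered linearised solutions about `u` are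
dependent modulo slice-wise constants — `u ≡ 0` on `t < 0`
(`typeIAncientMild_eq_zero_of_eLpNorm_two_le`) and the `u = 0` anchor `atZero_holds` applies.
[cite: KochNadirashviliSereginSverak2009, §4 p. 8 (arXiv:0709.3599)] -/
theorem dependentModSlice_of_eLpNorm_two_le {C N : ℝ} {u : ℝ → E3 → E3} (hA : InClassA C u)
    (hN : ∀ t < 0, eLpNorm (u t) 2 volume ≤ ENNReal.ofReal N)
    (v : Fin 7 → ℝ → E3 → E3) (q : Fin 7 → ℝ → E3 → ℝ) (h : SevenTempered u v q) :
    DependentModSlice v :=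
  have hz : ∀ t < 0, ∀ x, u t x = 0 :=
    typeIAncientMild_eq_zero_of_eLpNorm_two_le (isTypeIAncientMild_iff.2 hA) hN
  atZero_holds v q ((sevenTempered_iff 0 v q).1 (sevenTempered_zero_of_slice_zero hz h))

/-- **`LinearLiouvilleSeven` holds about every background with a uniformly bounded subcritical
Lebesgue norm** (`‖u(t)‖_{Lᵖ} ≤ N`, `1 ≤ p < 3`): such a `u ∈ A_C` vanishes on `t < 0`
(`typeIAncientMild_eq_zero_of_eLpNorm_le`) and the anchor applies.
[cite: KochNadirashviliSereginSverak2009, §4 p. 8 (arXiv:0709.3599)] -/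
theorem dependentModSlice_of_eLpNorm_le {C N : ℝ} {p : ℝ≥0∞} (hp1 : 1 ≤ p) (hp3 : p < 3)
    {u : ℝ → E3 → E3} (hA : InClassA C u)
    (hN : ∀ t < 0, eLpNorm (u t) p volume ≤ ENNReal.ofReal N)
    (v : Fin 7 → ℝ → E3 → E3) (q : Fin 7 → ℝ → E3 → ℝ) (h : SevenTempered u v q) :
    DependentModSlice v :=
  have hz : ∀ t < 0, ∀ x, u t x = 0 :=
    typeIAncientMild_eq_zero_of_eLpNorm_le hp1 hp3 (isTypeIAncientMild_iff.2 hA) hN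
  atZero_holds v q ((sevenTempered_iff 0 v q).1 (sevenTempered_zero_of_slice_zero hz h))

/-- **Registered stub `stub_typeIAncientLiouvilleSubcritical` of item stmt-NavierStokesRegularity-4054**
(raw vocabulary of the route file): the route target `X` on the part of `A_C` with a uniformly
bounded subcritical Lebesgue norm, `sup_{t<0} ‖u(t)‖_{Lᵖ} < ∞` for some `1 ≤ p < 3`.
[cite: KochNadirashviliSereginSverak2009, §4 p. 8 (arXiv:0709.3599)] -/
theorem stub_typeIAncientLiouvilleSubcritical :
    ∀ (p : ENNReal) (C N : ℝ) (u : ℝ → EuclideanSpace ℝ (Fin 3) → EuclideanSpace ℝ (Fin 3)), 1 ≤ p →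
      p < 3 → ContDiffOn ℝ (⊤ : ℕ∞) (Function.uncurry u) (Set.Iio 0 ×ˢ Set.univ) ∧ (∀ t < 0,
      Literature.Analysis.FluidPDE.VectorCalculus.IsDivFree (u t)) ∧ (∀ s t : ℝ, s < t → t < 0 → ∀
      x, u t x = Literature.Analysis.FluidPDE.heatFlow (u s) (t - s) x - ∫ τ in Set.Ioo s t, ∫ y,
      Literature.Analysis.FluidPDE.oseenKernel (t - τ) (x - y) (u τ y) (u τ y)) ∧
      Literature.Analysis.FluidPDE.HasTypeITimeDecay C u → (∀ t < 0, MeasureTheory.eLpNorm (u t) p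
      MeasureTheory.volume ≤ ENNReal.ofReal N) → ∀ t < 0, ∀ x, u t x = 0 :=
  fun _ _ _ _ hp1 hp3 hA hN => typeIAncientMild_eq_zero_of_eLpNorm_le hp1 hp3 (isTypeIAncientMild_iff.2 hA) hN

/-- **Registered stub `stub_typeIAncientLiouvilleFiniteEnergy` of item stmt-NavierStokesRegularity-4054**
(raw vocabulary of the route file): the route target `X` on the finite-energy part of `A_C` —
an element of `A_C` whose slices have uniformly bounded `L²` norm vanishes on `t < 0`.
[cite: KochNadirashviliSereginSverak2009, §4 p. 8 (arXiv:0709.3599)] -/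
theorem stub_typeIAncientLiouvilleFiniteEnergy :
    ∀ (C N : ℝ) (u : ℝ → EuclideanSpace ℝ (Fin 3) → EuclideanSpace ℝ (Fin 3)), ContDiffOn ℝ (⊤ : ℕ∞)
      (Function.uncurry u) (Set.Iio 0 ×ˢ Set.univ) ∧ (∀ t < 0,
      Literature.Analysis.FluidPDE.VectorCalculus.IsDivFree (u t)) ∧ (∀ s t : ℝ, s < t → t < 0 → ∀
      x, u t x = Literature.Analysis.FluidPDE.heatFlow (u s) (t - s) x - ∫ τ in Set.Ioo s t, ∫ y,
      Literature.Analysis.FluidPDE.oseenKernel (t - τ) (x - y) (u τ y) (u τ y)) ∧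
      Literature.Analysis.FluidPDE.HasTypeITimeDecay C u → (∀ t < 0, MeasureTheory.eLpNorm (u t) 2
      MeasureTheory.volume ≤ ENNReal.ofReal N) → ∀ t < 0, ∀ x, u t x = 0 :=
  fun _ _ _ hA hN => typeIAncientMild_eq_zero_of_eLpNorm_two_le (isTypeIAncientMild_iff.2 hA) hN

/-- **Registered stub `stub_linearLiouvilleSevenFiniteEnergy` of item stmt-NavierStokesRegularity-4054**
(raw vocabulary of the route file): `LinearLiouvilleSeven` restricted to finite-energy
backgrounds holds. [cite: KochNadirashviliSereginSverak2009, §4 p. 8 (arXiv:0709.3599)] -/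
theorem stub_linearLiouvilleSevenFiniteEnergy :
    ∀ (C N : ℝ) (u : ℝ → EuclideanSpace ℝ (Fin 3) → EuclideanSpace ℝ (Fin 3)), ContDiffOn ℝ (⊤ : ℕ∞)
      (Function.uncurry u) (Set.Iio 0 ×ˢ Set.univ) ∧ (∀ t < 0,
      Literature.Analysis.FluidPDE.VectorCalculus.IsDivFree (u t)) ∧ (∀ s t : ℝ, s < t → t < 0 → ∀
      x, u t x = Literature.Analysis.FluidPDE.heatFlow (u s) (t - s) x - ∫ τ in Set.Ioo s t, ∫ y,
      Literature.Analysis.FluidPDE.oseenKernel (t - τ) (x - y) (u τ y) (u τ y)) ∧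
      Literature.Analysis.FluidPDE.HasTypeITimeDecay C u → (∀ t < 0, MeasureTheory.eLpNorm (u t) 2
      MeasureTheory.volume ≤ ENNReal.ofReal N) → ∀ (v : Fin 7 → ℝ → EuclideanSpace ℝ (Fin 3) →
      EuclideanSpace ℝ (Fin 3)) (q : Fin 7 → ℝ → EuclideanSpace ℝ (Fin 3) → ℝ), (∀ i, (ContDiffOn ℝ
      (⊤ : ℕ∞) (Function.uncurry (v i)) (Set.Iio 0 ×ˢ Set.univ) ∧ ContDiffOn ℝ (⊤ : ℕ∞)
      (Function.uncurry (q i)) (Set.Iio 0 ×ˢ Set.univ) ∧ (∃ K : ℝ, ∀ t < 0, ∀ x, ‖(v i) t x‖ ≤ K /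
      Real.sqrt (-t) + K * (1 + ‖x‖) / (-t) ∧ |(q i) t x| ≤ K / (-t) + K * (1 + ‖x‖) / Real.sqrt
      (-t) ^ 3) ∧ (∀ t < 0, Literature.Analysis.FluidPDE.VectorCalculus.IsDivFree ((v i) t)) ∧ (∀ t
      < 0, ∀ x, Literature.Analysis.FluidPDE.timeDeriv (v i) t x +
      Literature.Analysis.FluidPDE.convect (u t) ((v i) t) x + Literature.Analysis.FluidPDE.convect
      ((v i) t) (u t) x = Laplacian.laplacian ((v i) t) x - gradient ((q i) t) x))) → ∃ c : Fin 7 →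
      ℝ, c ≠ 0 ∧ ∀ t < 0, ∃ b : EuclideanSpace ℝ (Fin 3), ∀ x, ∑ i, c i • v i t x = b :=
  fun _ _ _ hA hN v q h => dependentModSlice_of_eLpNorm_two_le hA hN v q h

end Summit.NavierStokesRegularity.NavierStokesRegularity.Theorems

end
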